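import Summits.RiemannHypothesis.RiemannHypothesis.Theorems.OddSectorOddOneSignedWindowsExistence
import HarnessLib

/-!
# Route OddSector — crux `OddOneSignedWindows` (stmt-RiemannHypothesis-17778): renormalisation
# and an approximation criterion for good windows

The crux asks, beyond every height, for a window `a` carrying an odd-sector ground state of
Weil's form (`Literature.NumberTheory.LFunctions.IsWeilOddGroundState a u`) that is real and
`≥ 0` a.e. on `(0, a)` — call such a window GOOD. Existence of odd ground states
(`OddSector.exists_isWeilOddGroundState`) and of real-valued ones
(`OddSectorOddOneSignedWindowsRealPart.lean`) being settled, only the SIGN is at stake. This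
file supplies RH-free functional-analytic tools that turn APPROXIMATE data into a good window,
in the operator-free encoding of the tree:

* `weilOddGroundEnergy_mul_le_re` — coercivity on the odd window, `ε_od(a)·∫|f|² ≤ Re Q(f)`
  for odd window tests (so the DEFECT `Re Q(f) − ε_od(a)∫|f|²` is `≥ 0`);
* `tendsto_integral_norm_sq_of_tendsto_sub` — masses converge under `L²` convergence;
* `isWeilOddGroundState_of_defect_tendsto_zero` — RENORMALISATION LEMMA: odd window tests
  `fₙ → w` in `L²` with `∫|w|² = ρ > 0` and defects `→ 0` make `w/√ρ` an odd-sector ground state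
  (no normalisation of the `fₙ` is required; e.g. shifted-resolvent approximants
  `(ε_od − E)·v_E`, `E ↑ ε_od`, of the route's θ-road have exactly this shape);
* `ae_sign_of_tendsto` — one-signedness passes to `L²` limits: if the `fₙ` are real and `≥ 0`
  on `(0, a)` then so is `w`, a.e.;
* `exists_oneSigned_groundState_of_defect_tendsto_zero` — the APPROXIMATION CRITERION: real,
  nonnegative-on-`(0,a)` odd window tests converging in `L²` to a non-zero limit with vanishing
  defects certify that the window is good; `oddOneSignedWindows_of_approximants` lifts it to the
  crux;
* `rePart_groundState_of_sign`, `oddOneSignedWindows_iff_real_nonneg` — the crux is EQUIVALENT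
  to its nonnegativity clause for (pointwise) real odd ground states.

## References
* E. Bombieri, *Remarks on Weil's quadratic functional in the theory of prime numbers I*, Rend.
  Mat. Acc. Lincei (9) 11 (2000), §4 Problem 2, Thm. 3 (minimising sequences converge in `L²`).
-/

noncomputable section

-- `Summit.RiemannHypothesis.RiemannHypothesis.…` repeats the summit name by design (D-0017 layout).
set_option linter.dupNamespace false

open Complex Filter Set MeasureTheory
open scoped Topology ComplexConjugate

namespace Summit.RiemannHypothesis.RiemannHypothesis.Theorems.OddSector

open Literature.NumberTheory.LFunctions

/-! ## §1. Coercivity on the odd window -/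

section Coercivity

variable {a : ℝ}

/-- **Coercivity on the odd window** (odd twin of `weilGroundEnergy_mul_le_re`): for an odd test
function `f` supported in `[-a, a]`, `ε_od(a) · ∫|f|² ≤ Re Q(f)` (normalise `f ≠ 0` onto the odd
sphere, `weilOddGroundEnergy_le`, `Q(c f) = |c|² Q(f)`; `Q(0) = 0`). -/
theorem weilOddGroundEnergy_mul_le_re {f : ℝ → ℂ} (hf : IsWeilTest f)
    (hsupp : tsupport f ⊆ Icc (-a) a) (hodd : ∀ t, f (-t) = -f t) :
    weilOddGroundEnergy a * ∫ t, ‖f t‖ ^ 2 ≤ (weilQuadratic f).re := by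
  have hN2nn : 0 ≤ ∫ t : ℝ, ‖f t‖ ^ 2 := integral_nonneg fun _ ↦ by positivity
  rcases hN2nn.eq_or_lt with hz | hpos
  · have hf0 : f = 0 := hf.eq_zero_of_integral_norm_sq_eq_zero hz.symm
    subst hf0
    rw [weilQuadratic_zero, Complex.zero_re, ← hz, mul_zero]
  · set N2 : ℝ := ∫ t : ℝ, ‖f t‖ ^ 2 with hN2
    set c : ℝ := (Real.sqrt N2)⁻¹ with hc
    have hcpos : 0 < c := inv_pos.2 (Real.sqrt_pos.2 hpos)
    have hnorm' : ∫ t : ℝ, ‖(c : ℂ) * f t‖ ^ 2 = 1 := by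
      simp only [norm_mul, mul_pow, Complex.norm_real, Real.norm_of_nonneg hcpos.le]
      rw [integral_const_mul, hc, inv_pow, Real.sq_sqrt hN2nn, inv_mul_cancel₀ hpos.ne']
    have hle : weilOddGroundEnergy a ≤ (weilQuadratic fun t ↦ (c : ℂ) * f t).re :=
      weilOddGroundEnergy_le (hf.const_mul c) (tsupport_mul_subset_right.trans hsupp)
        (fun t ↦ by rw [hodd t, mul_neg]) hnorm'
    have hQ' : (weilQuadratic fun t ↦ (c : ℂ) * f t).re = c * c * (weilQuadratic f).re := by
      rw [weilQuadratic_const_mul, Complex.normSq_ofReal, Complex.re_ofReal_mul]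
    have hcc : c * c * N2 = 1 := by
      rw [hc, ← mul_inv, Real.mul_self_sqrt hN2nn, inv_mul_cancel₀ hpos.ne']
    have h1 : weilOddGroundEnergy a * (c * c * N2) ≤ c * c * (weilQuadratic f).re := by
      rw [hcc, mul_one, ← hQ']
      exact hle
    have h2 : c * c * (weilOddGroundEnergy a * N2) ≤ c * c * (weilQuadratic f).re := by linarith
    exact le_of_mul_le_mul_left h2 (mul_pos hcpos hcpos)

end Coercivity

/-! ## §2. `L²` bookkeeping: masses of `L²`-convergent sequences, renormalisation -/

section L2

variable {f : ℕ → ℝ → ℂ} {w : ℝ → ℂ}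

/-- If `fₙ → w` in `L²` then the masses converge: `∫|fₙ|² → ∫|w|²` (Minkowski both ways:
`|‖fₙ‖₂ − ‖w‖₂| ≤ ‖fₙ − w‖₂`). -/
theorem tendsto_integral_norm_sq_of_tendsto_sub (hf : ∀ n, MemLp (f n) 2) (hw : MemLp w 2)
    (hlim : Tendsto (fun n ↦ ∫ t, ‖f n t - w t‖ ^ 2) atTop (𝓝 0)) :
    Tendsto (fun n ↦ ∫ t, ‖f n t‖ ^ 2) atTop (𝓝 (∫ t, ‖w t‖ ^ 2)) := by
  have hsqrt : Tendsto (fun n ↦ Real.sqrt (∫ t, ‖f n t - w t‖ ^ 2)) atTop (𝓝 0) := by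
    simpa using hlim.sqrt
  set S : ℝ := Real.sqrt (∫ t, ‖w t‖ ^ 2) with hS
  -- `‖fₙ‖₂ ≤ ‖w‖₂ + ‖fₙ - w‖₂` and `‖w‖₂ ≤ ‖fₙ‖₂ + ‖fₙ - w‖₂`
  have h1 : ∀ n, Real.sqrt (∫ t, ‖f n t‖ ^ 2) ≤ S + Real.sqrt (∫ t, ‖f n t - w t‖ ^ 2) := fun n ↦ by
    have := sqrt_integral_norm_sq_sub_le hw (hw.sub (hf n))
    simpa only [Pi.sub_apply, sub_sub_cancel, norm_sub_rev (w _) (f n _)] using this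
  have h2 : ∀ n, S ≤ Real.sqrt (∫ t, ‖f n t‖ ^ 2) + Real.sqrt (∫ t, ‖f n t - w t‖ ^ 2) := fun n ↦ by
    have := sqrt_integral_norm_sq_sub_le (hf n) ((hf n).sub hw)
    simpa only [Pi.sub_apply, sub_sub_cancel] using this
  -- hence `√∫|fₙ|² → S`
  have hsq : Tendsto (fun n ↦ Real.sqrt (∫ t, ‖f n t‖ ^ 2)) atTop (𝓝 S) := by
    refine tendsto_of_tendsto_of_tendsto_of_le_of_le (g := fun n ↦ S - Real.sqrt (∫ t, ‖f n t - w t‖ ^ 2))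
      (h := fun n ↦ S + Real.sqrt (∫ t, ‖f n t - w t‖ ^ 2)) ?_ ?_ (fun n ↦ by linarith [h2 n])
      (fun n ↦ h1 n)
    · simpa using tendsto_const_nhds.sub hsqrt
    · simpa using tendsto_const_nhds.add hsqrt
  have hnn : ∀ n, 0 ≤ ∫ t, ‖f n t‖ ^ 2 := fun n ↦ integral_nonneg fun _ ↦ by positivity
  have hnnw : 0 ≤ ∫ t, ‖w t‖ ^ 2 := integral_nonneg fun _ ↦ by positivity
  have := hsq.pow 2
  simp only [Real.sq_sqrt (hnn _)] at this
  rwa [hS, Real.sq_sqrt hnnw] at this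

/-- Scaling of the `L²` mass by a real constant: `∫ |c f|² = c² ∫ |f|²`. -/
theorem integral_norm_sq_real_mul (c : ℝ) (g : ℝ → ℂ) :
    ∫ t, ‖(c : ℂ) * g t‖ ^ 2 = c ^ 2 * ∫ t, ‖g t‖ ^ 2 := by
  simp only [norm_mul, mul_pow, Complex.norm_real, Real.norm_eq_abs, sq_abs]
  exact integral_const_mul _ _

/-- **Renormalisation lemma.** Let `fₙ` be odd window test functions converging in `L²` to `w`
with `∫|w|² = ρ > 0`, and suppose the DEFECTS `Re Q(fₙ) − ε_od(a)∫|fₙ|²` tend to `0`. Then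
`w/√ρ` is an odd-sector ground state: the renormalised tail `fₙ/‖fₙ‖₂` (defined once
`‖fₙ‖₂² > ρ/2`) is an `L²`-normalised odd minimising sequence converging to `w/√ρ` in `L²`. -/
theorem isWeilOddGroundState_of_defect_tendsto_zero {a ρ : ℝ}
    (hf : ∀ n, IsWeilTest (f n) ∧ tsupport (f n) ⊆ Icc (-a) a ∧ (∀ t, f n (-t) = -f n t))
    (hw : MemLp w 2) (hρ : 0 < ρ) (hρw : ∫ t, ‖w t‖ ^ 2 = ρ)
    (hdef : Tendsto (fun n ↦ (weilQuadratic (f n)).re - weilOddGroundEnergy a * ∫ t, ‖f n t‖ ^ 2)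
      atTop (𝓝 0))
    (hlim : Tendsto (fun n ↦ ∫ t, ‖f n t - w t‖ ^ 2) atTop (𝓝 0)) :
    IsWeilOddGroundState a (fun t ↦ ((Real.sqrt ρ)⁻¹ : ℝ) * w t) := by
  have hfm : ∀ n, MemLp (f n) 2 := fun n ↦
    (hf n).1.1.continuous.memLp_of_hasCompactSupport (hf n).1.2
  set N : ℕ → ℝ := fun n ↦ ∫ t, ‖f n t‖ ^ 2 with hN
  have hmass : Tendsto N atTop (𝓝 ρ) := by
    have := tendsto_integral_norm_sq_of_tendsto_sub hfm hw hlim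
    rwa [hρw] at this
  -- from some index on, `N n > ρ / 2`
  obtain ⟨n₀, hn₀⟩ : ∃ n₀, ∀ n, n₀ ≤ n → ρ / 2 < N n := by
    have hev : ∀ᶠ n in atTop, ρ / 2 < N n := hmass.eventually (Ioi_mem_nhds (by linarith))
    exact eventually_atTop.1 hev
  have hNpos : ∀ n, 0 < N (n + n₀) := fun n ↦ lt_trans (by linarith) (hn₀ (n + n₀) (by omega))
  -- the renormalised tail
  set c : ℕ → ℝ := fun n ↦ (Real.sqrt (N (n + n₀)))⁻¹ with hc
  have hcpos : ∀ n, 0 < c n := fun n ↦ inv_pos.2 (Real.sqrt_pos.2 (hNpos n))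
  set v : ℕ → ℝ → ℂ := fun n t ↦ (c n : ℂ) * f (n + n₀) t with hv
  set cinf : ℝ := (Real.sqrt ρ)⁻¹ with hcinf
  have hcinfpos : 0 < cinf := inv_pos.2 (Real.sqrt_pos.2 hρ)
  have hshift : Tendsto (fun n ↦ n + n₀) atTop atTop := tendsto_add_atTop_nat n₀
  -- (i) the tail lies on the odd sphere
  have hvS : ∀ n, IsWeilTest (v n) ∧ tsupport (v n) ⊆ Icc (-a) a ∧ (∀ t, v n (-t) = -v n t) ∧
      ∫ t, ‖v n t‖ ^ 2 = (1 : ℝ) := fun n ↦ by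
    refine ⟨(hf _).1.const_mul _, tsupport_mul_subset_right.trans (hf _).2.1,
      fun t ↦ by simp only [hv, (hf _).2.2 t, mul_neg], ?_⟩
    simp only [hv]
    rw [integral_norm_sq_real_mul, hc, inv_pow, Real.sq_sqrt (hNpos n).le]
    exact inv_mul_cancel₀ (hNpos n).ne'
  -- (ii) energies: `Re Q(vₙ) = Re Q(f_{n+n₀}) / N = ε + defect / N → ε`
  have hQv : ∀ n, (weilQuadratic (v n)).re =
      weilOddGroundEnergy a + ((weilQuadratic (f (n + n₀))).re -
        weilOddGroundEnergy a * N (n + n₀)) / N (n + n₀) := fun n ↦ by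
    simp only [hv]
    rw [weilQuadratic_const_mul, Complex.normSq_ofReal, Complex.re_ofReal_mul, hc, ← mul_inv,
      Real.mul_self_sqrt (hNpos n).le]
    field_simp [(hNpos n).ne']
    ring
  have hQ : Tendsto (fun n ↦ (weilQuadratic (v n)).re) atTop (𝓝 (weilOddGroundEnergy a)) := by
    simp only [hQv]
    have h1 : Tendsto (fun n ↦ ((weilQuadratic (f (n + n₀))).re -
        weilOddGroundEnergy a * N (n + n₀)) / N (n + n₀)) atTop (𝓝 (0 / ρ)) :=
      (hdef.comp hshift).div (hmass.comp hshift) hρ.ne'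
    rw [zero_div] at h1
    simpa using tendsto_const_nhds.add h1
  -- (iii) `L²` convergence of the tail to `cinf w`
  have hcn : Tendsto c atTop (𝓝 cinf) := by
    simp only [hc, hcinf]
    exact ((hmass.comp hshift).sqrt.inv₀ (Real.sqrt_pos.2 hρ).ne')
  have hL : Tendsto (fun n ↦ ∫ t, ‖v n t - (cinf : ℂ) * w t‖ ^ 2) atTop (𝓝 0) := by
    -- Minkowski: `‖cₙ f − cinf w‖₂ ≤ |cₙ − cinf| ‖f‖₂ + cinf ‖f − w‖₂`
    have hbound : ∀ n, Real.sqrt (∫ t, ‖v n t - (cinf : ℂ) * w t‖ ^ 2) ≤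
        |c n - cinf| * Real.sqrt (N (n + n₀)) +
          cinf * Real.sqrt (∫ t, ‖f (n + n₀) t - w t‖ ^ 2) := fun n ↦ by
      have hF : MemLp (fun t ↦ ((c n - cinf : ℝ) : ℂ) * f (n + n₀) t) 2 := (hfm _).const_mul _
      have hH : MemLp (fun t ↦ ((-cinf : ℝ) : ℂ) * (f (n + n₀) t - w t)) 2 :=
        ((hfm _).sub hw).const_mul _
      have key := sqrt_integral_norm_sq_sub_le hF hH
      have e1 : ∀ t, ((c n - cinf : ℝ) : ℂ) * f (n + n₀) t - ((-cinf : ℝ) : ℂ) * (f (n + n₀) t - w t) =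
          v n t - (cinf : ℂ) * w t := fun t ↦ by
        simp only [hv]; push_cast; ring
      simp only [e1, integral_norm_sq_real_mul, Real.sqrt_mul (sq_nonneg _), Real.sqrt_sq_eq_abs,
        abs_neg, abs_of_pos hcinfpos] at key
      exact key
    have hlim0 : Tendsto (fun n ↦ |c n - cinf| * Real.sqrt (N (n + n₀)) +
        cinf * Real.sqrt (∫ t, ‖f (n + n₀) t - w t‖ ^ 2)) atTop (𝓝 0) := by
      have t1 : Tendsto (fun n ↦ |c n - cinf| * Real.sqrt (N (n + n₀))) atTop (𝓝 (0 * Real.sqrt ρ)) := by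
        refine Tendsto.mul ?_ (hmass.comp hshift).sqrt
        have := (hcn.sub_const cinf).abs
        simpa using this
      have t2 : Tendsto (fun n ↦ cinf * Real.sqrt (∫ t, ‖f (n + n₀) t - w t‖ ^ 2)) atTop (𝓝 (cinf * 0)) := by
        exact tendsto_const_nhds.mul (by simpa using (hlim.comp hshift).sqrt)
      simpa using t1.add t2
    have hsq : Tendsto (fun n ↦ Real.sqrt (∫ t, ‖v n t - (cinf : ℂ) * w t‖ ^ 2)) atTop (𝓝 0) :=
      tendsto_of_tendsto_of_tendsto_of_le_of_le tendsto_const_nhds hlim0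
        (fun n ↦ Real.sqrt_nonneg _) hbound
    have hnn : ∀ n, 0 ≤ ∫ t, ‖v n t - (cinf : ℂ) * w t‖ ^ 2 := fun n ↦
      integral_nonneg fun _ ↦ by positivity
    have := hsq.pow 2
    simpa only [Real.sq_sqrt (hnn _), ne_eq, OfNat.ofNat_ne_zero, not_false_eq_true,
      zero_pow] using this
  exact IsWeilOddGroundState.of_tendsto (hw.const_mul _) hvS hQ hL

end L2

/-! ## §3. One-signedness passes to `L²` limits -/

section Sign

variable {f : ℕ → ℝ → ℂ} {w : ℝ → ℂ} {a : ℝ}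

/-- Pointwise: the squared distance from `z` to the cone `[0, ∞) ⊆ ℂ`,
`(min (Re z) 0)² + (Im z)²`, is at most `|x − z|²` for every `x` in the cone. -/
theorem min_re_sq_add_im_sq_le {x z : ℂ} (hx : x.im = 0 ∧ 0 ≤ x.re) :
    (min z.re 0) ^ 2 + z.im ^ 2 ≤ ‖x - z‖ ^ 2 := by
  rw [Complex.sq_norm, Complex.normSq_apply, Complex.sub_re, Complex.sub_im, hx.1, zero_sub]
  have h1 : (min z.re 0) ^ 2 ≤ (x.re - z.re) * (x.re - z.re) := by
    rcases le_or_gt z.re 0 with hz | hz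
    · rw [min_eq_left hz]; nlinarith [hx.2]
    · rw [min_eq_right hz.le]; nlinarith
  nlinarith

/-- **One-signedness passes to `L²` limits.** If `fₙ → w` in `L²` (`w ∈ L²`, `fₙ ∈ L²`) and every
`fₙ` is real and `≥ 0` on `(0, a)`, then `w` is real and `≥ 0` a.e. on `(0, a)`: the squared
distance of `w(t)` to the cone `[0, ∞)` is dominated by `|fₙ(t) − w(t)|²`, whose integral tends
to `0`. -/
theorem ae_sign_of_tendsto (hfm : ∀ n, MemLp (f n) 2) (hw : MemLp w 2)
    (hsign : ∀ n t, t ∈ Ioo 0 a → (f n t).im = 0 ∧ 0 ≤ (f n t).re)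
    (hlim : Tendsto (fun n ↦ ∫ t, ‖f n t - w t‖ ^ 2) atTop (𝓝 0)) :
    ∀ᵐ t : ℝ, t ∈ Ioo 0 a → (w t).im = 0 ∧ 0 ≤ (w t).re := by
  set D : ℝ → ℝ := (Ioo 0 a).indicator fun t ↦ (min (w t).re 0) ^ 2 + (w t).im ^ 2 with hD
  have hDnn : ∀ t, 0 ≤ D t := fun t ↦ by
    simp only [hD]
    exact Set.indicator_nonneg (fun _ _ ↦ by positivity) _
  have hDle : ∀ n t, D t ≤ ‖f n t - w t‖ ^ 2 := fun n t ↦ by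
    simp only [hD, Set.indicator_apply]
    split_ifs with ht
    · exact min_re_sq_add_im_sq_le (hsign n t ht)
    · positivity
  have hsub : ∀ n, Integrable fun t ↦ ‖f n t - w t‖ ^ 2 := fun n ↦
    (memLp_two_iff_integrable_sq_norm ((hfm n).sub hw).1).1 ((hfm n).sub hw)
  -- `∫ D ≤ ∫ |fₙ − w|² → 0`, so `∫ D = 0`
  have hI : ∀ n, ∫ t, D t ≤ ∫ t, ‖f n t - w t‖ ^ 2 := fun n ↦
    integral_mono_of_nonneg (Eventually.of_forall hDnn) (hsub n) (Eventually.of_forall (hDle n))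
  have hI0 : ∫ t, D t = 0 :=
    le_antisymm (ge_of_tendsto' hlim hI) (integral_nonneg hDnn)
  -- `D` is integrable (dominated by `|f₀ − w|²`) hence `D = 0` a.e.
  have hDm : AEStronglyMeasurable D volume := by
    have hre : AEMeasurable (fun t ↦ (w t).re) volume :=
      Complex.measurable_re.comp_aemeasurable hw.1.aemeasurable
    have him : AEMeasurable (fun t ↦ (w t).im) volume :=
      Complex.measurable_im.comp_aemeasurable hw.1.aemeasurable
    exact (((hre.min aemeasurable_const).pow_const 2).add (him.pow_const 2)).indicator
      measurableSet_Ioo |>.aestronglyMeasurable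
  have hDint : Integrable D :=
    Integrable.mono' (hsub 0) hDm (Eventually.of_forall fun t ↦ by
      rw [Real.norm_of_nonneg (hDnn t)]; exact hDle 0 t)
  have hae : D =ᵐ[volume] 0 := (integral_eq_zero_iff_of_nonneg hDnn hDint).1 hI0
  filter_upwards [hae] with t ht hta
  have h0 : (min (w t).re 0) ^ 2 + (w t).im ^ 2 = 0 := by
    simpa [hD, Set.indicator_of_mem hta] using ht
  have h1 : (min (w t).re 0) ^ 2 = 0 := by nlinarith [sq_nonneg (min (w t).re 0), sq_nonneg (w t).im]
  have h2 : (w t).im ^ 2 = 0 := by nlinarith [sq_nonneg (min (w t).re 0), sq_nonneg (w t).im]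
  refine ⟨pow_eq_zero_iff (n := 2) two_ne_zero |>.1 h2, ?_⟩
  have h3 : min (w t).re 0 = 0 := pow_eq_zero_iff (n := 2) two_ne_zero |>.1 h1
  exact min_eq_right_iff.1 h3

end Sign

/-! ## §4. The approximation criterion for good windows; the crux as a real sign statement -/

/-- **Approximation criterion for a good window** (RH-free). Let `fₙ` be odd window test
functions on `[-a, a]` that are REAL and `≥ 0` on `(0, a)`, converging in `L²` to `w` with
`∫|w|² = ρ > 0`, and whose defects `Re Q(fₙ) − ε_od(a)∫|fₙ|²` tend to `0`. Then the window `a`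
carries a one-signed odd-sector ground state, namely `w/√ρ`
(`isWeilOddGroundState_of_defect_tendsto_zero` + `ae_sign_of_tendsto`). -/
theorem exists_oneSigned_groundState_of_defect_tendsto_zero {f : ℕ → ℝ → ℂ} {w : ℝ → ℂ}
    {a ρ : ℝ}
    (hf : ∀ n, IsWeilTest (f n) ∧ tsupport (f n) ⊆ Icc (-a) a ∧ (∀ t, f n (-t) = -f n t))
    (hsign : ∀ n t, t ∈ Ioo 0 a → (f n t).im = 0 ∧ 0 ≤ (f n t).re)
    (hw : MemLp w 2) (hρ : 0 < ρ) (hρw : ∫ t, ‖w t‖ ^ 2 = ρ)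
    (hdef : Tendsto (fun n ↦ (weilQuadratic (f n)).re - weilOddGroundEnergy a * ∫ t, ‖f n t‖ ^ 2)
      atTop (𝓝 0))
    (hlim : Tendsto (fun n ↦ ∫ t, ‖f n t - w t‖ ^ 2) atTop (𝓝 0)) :
    ∃ v : ℝ → ℂ, IsWeilOddGroundState a v ∧
      ∀ᵐ t : ℝ, t ∈ Ioo 0 a → (v t).im = 0 ∧ 0 ≤ (v t).re := by
  refine ⟨_, isWeilOddGroundState_of_defect_tendsto_zero hf hw hρ hρw hdef hlim, ?_⟩
  have hfm : ∀ n, MemLp (f n) 2 := fun n ↦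
    (hf n).1.1.continuous.memLp_of_hasCompactSupport (hf n).1.2
  have hc : 0 < (Real.sqrt ρ)⁻¹ := inv_pos.2 (Real.sqrt_pos.2 hρ)
  filter_upwards [ae_sign_of_tendsto hfm hw hsign hlim] with t ht hta
  obtain ⟨him, hre⟩ := ht hta
  refine ⟨by simp [Complex.mul_im, him], ?_⟩
  simp only [Complex.mul_re, Complex.ofReal_re, Complex.ofReal_im, him, mul_zero, sub_zero]
  exact mul_nonneg hc.le hre

/-- **The crux from approximants.** If beyond every height some window `a` admits odd window
tests, real and `≥ 0` on `(0, a)`, converging in `L²` to a non-zero limit with vanishing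
defects, then `OddOneSignedWindows` holds. -/
theorem oddOneSignedWindows_of_approximants
    (h : ∀ A : ℝ, ∃ a : ℝ, A ≤ a ∧ ∃ (f : ℕ → ℝ → ℂ) (w : ℝ → ℂ) (ρ : ℝ),
      (∀ n, IsWeilTest (f n) ∧ tsupport (f n) ⊆ Icc (-a) a ∧ (∀ t, f n (-t) = -f n t)) ∧
      (∀ n t, t ∈ Ioo 0 a → (f n t).im = 0 ∧ 0 ≤ (f n t).re) ∧
      MemLp w 2 ∧ 0 < ρ ∧ ∫ t, ‖w t‖ ^ 2 = ρ ∧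
      Tendsto (fun n ↦ (weilQuadratic (f n)).re - weilOddGroundEnergy a * ∫ t, ‖f n t‖ ^ 2)
        atTop (𝓝 0) ∧
      Tendsto (fun n ↦ ∫ t, ‖f n t - w t‖ ^ 2) atTop (𝓝 0)) :
    Summit.RiemannHypothesis.RiemannHypothesis.Theses.OddSector.OddOneSignedWindows := by
  rw [oddOneSignedWindows_iff]
  intro A
  obtain ⟨a, hAa, f, w, ρ, hf, hsign, hw, hρ, hρw, hdef, hlim⟩ := h A
  exact ⟨a, hAa, exists_oneSigned_groundState_of_defect_tendsto_zero hf hsign hw hρ hρw hdef hlim⟩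

/-- **An a.e.-one-signed odd ground state is a.e. real, hence has a real representative.** If an
odd ground state `u` is real and `≥ 0` a.e. on `(0, a)`, then `Re u` (pointwise real) is an odd
ground state, `≥ 0` a.e. on `(0, a)`: `u` is a.e. odd (`.ae_neg`) and vanishes a.e. off the
window (`.ae_eq_zero_of_notMem`), so `u = Re u` a.e. and `.congr_ae` applies. -/
theorem rePart_groundState_of_sign {a : ℝ} {u : ℝ → ℂ} (hu : IsWeilOddGroundState a u)
    (hsign : ∀ᵐ t : ℝ, t ∈ Ioo 0 a → (u t).im = 0 ∧ 0 ≤ (u t).re) :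
    IsWeilOddGroundState a (fun t ↦ ((u t).re : ℂ)) ∧
      ∀ᵐ t : ℝ, t ∈ Ioo 0 a → 0 ≤ (u t).re := by
  refine ⟨hu.congr_ae ?_, by filter_upwards [hsign] with t h1 ht using (h1 ht).2⟩
  have hrefl : ∀ᵐ t : ℝ, -t ∈ Ioo 0 a → (u (-t)).im = 0 ∧ 0 ≤ (u (-t)).re :=
    (Measure.measurePreserving_neg (volume : Measure ℝ)).quasiMeasurePreserving.tendsto_ae.eventually
      hsign
  have hnull : ∀ᵐ t : ℝ, t ∉ ({0, a, -a} : Set ℝ) :=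
    measure_eq_zero_iff_ae_notMem.1 ((Set.toFinite _).measure_zero volume)
  filter_upwards [hsign, hrefl, hu.ae_neg, hu.ae_eq_zero_of_notMem, hnull] with t h1 h2 h3 h4 h5
  simp only [mem_insert_iff, mem_singleton_iff, not_or] at h5
  obtain ⟨ht0, hta, hta'⟩ := h5
  apply Complex.ext
  · simp
  · rw [Complex.ofReal_im]
    rcases lt_or_gt_of_ne ht0 with ht | ht
    · by_cases hlt : -a < t
      · have him : (u (-t)).im = 0 := (h2 ⟨by linarith, by linarith⟩).1
        rw [h3] at him
        simpa using him
      · have hout : t ∉ Icc (-a) a := fun hm ↦ hlt (lt_of_le_of_ne hm.1 (Ne.symm hta'))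
        simp [h4 hout]
    · by_cases hlt : t < a
      · exact (h1 ⟨ht, hlt⟩).1
      · have hout : t ∉ Icc (-a) a := fun hm ↦ hlt (lt_of_le_of_ne hm.2 hta)
        simp [h4 hout]

/-- **The crux is its nonnegativity clause for REAL odd ground states.** `OddOneSignedWindows`
holds iff beyond every height some window carries a real-valued (pointwise) odd-sector ground
state that is `≥ 0` a.e. on the right half-window. (`→`: `rePart_groundState_of_sign`;
`←`: immediate.) Combined with `exists_isWeilOddGroundState_real`, only the SIGN of a real odd
bottom state on `(0, a)` is at stake. -/
theorem oddOneSignedWindows_iff_real_nonneg :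
    Summit.RiemannHypothesis.RiemannHypothesis.Theses.OddSector.OddOneSignedWindows ↔
      ∀ A : ℝ, ∃ a : ℝ, A ≤ a ∧ ∃ v : ℝ → ℂ, IsWeilOddGroundState a v ∧ (∀ t, (v t).im = 0) ∧
        ∀ᵐ t : ℝ, t ∈ Ioo 0 a → 0 ≤ (v t).re := by
  rw [oddOneSignedWindows_iff]
  constructor
  · intro H A
    obtain ⟨a, hAa, u, hu, hsign⟩ := H A
    obtain ⟨hv, hv'⟩ := rePart_groundState_of_sign hu hsign
    exact ⟨a, hAa, _, hv, fun t ↦ by simp, by simpa using hv'⟩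
  · intro H A
    obtain ⟨a, hAa, v, hv, hreal, hsign⟩ := H A
    exact ⟨a, hAa, v, hv, by filter_upwards [hsign] with t h1 ht using ⟨hreal t, h1 ht⟩⟩

end Summit.RiemannHypothesis.RiemannHypothesis.Theorems.OddSector

end
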